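import Literature.MathematicalPhysics.QuantumFieldTheory.ConformalBootstrap3D.PointKernelK34Data

/-!
# K34 certificate, kernel block file M3: (M) rows `31 ≤ j < 42` of `mrows`, in 9 row groups

`decide` by kernel reduction (no `native_decide`, no extra axioms) of the block checker of
`PointKernel` on the literal data of `PointKernelK34Data`; soundness is `PCert.mBlockOK_sound`.
Estimated kernel time 179 s (9 theorems).
-/

set_option maxRecDepth 100000
set_option maxHeartbeats 0

namespace Literature.MathematicalPhysics.QuantumFieldTheory.ConformalBootstrap3D.PointKernelK34

open Literature.MathematicalPhysics.QuantumFieldTheory.ConformalBootstrap3D.PointKernel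

/-- (M) rows `[31, 32)` pass the kernel evaluator. [folklore] -/
theorem mBlock_31 : cert.mBlockOK mrows 31 32 = true := by
  decide +kernel

/-- (M) rows `[32, 33)` pass the kernel evaluator. [folklore] -/
theorem mBlock_32 : cert.mBlockOK mrows 32 33 = true := by
  decide +kernel

/-- (M) rows `[33, 34)` pass the kernel evaluator. [folklore] -/
theorem mBlock_33 : cert.mBlockOK mrows 33 34 = true := by
  decide +kernel

/-- (M) rows `[34, 35)` pass the kernel evaluator. [folklore] -/
theorem mBlock_34 : cert.mBlockOK mrows 34 35 = true := by
  decide +kernel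

/-- (M) rows `[35, 36)` pass the kernel evaluator. [folklore] -/
theorem mBlock_35 : cert.mBlockOK mrows 35 36 = true := by
  decide +kernel

/-- (M) rows `[36, 37)` pass the kernel evaluator. [folklore] -/
theorem mBlock_36 : cert.mBlockOK mrows 36 37 = true := by
  decide +kernel

/-- (M) rows `[37, 38)` pass the kernel evaluator. [folklore] -/
theorem mBlock_37 : cert.mBlockOK mrows 37 38 = true := by
  decide +kernel

/-- (M) rows `[38, 40)` pass the kernel evaluator. [folklore] -/
theorem mBlock_38 : cert.mBlockOK mrows 38 40 = true := by
  decide +kernel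

/-- (M) rows `[40, 42)` pass the kernel evaluator. [folklore] -/
theorem mBlock_40 : cert.mBlockOK mrows 40 42 = true := by
  decide +kernel

end Literature.MathematicalPhysics.QuantumFieldTheory.ConformalBootstrap3D.PointKernelK34
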